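import Literature.Barriers.CriticalPhenomena.GridSAWFormulaStampCompatB
import HarnessLib

/-!
# The grid drawing of the graph of a formula, IV: bundles and the soundness of the realisability filter

The objects of the grid drawing `E₀` of the graph of a formula (`GridSAWFormulaDrawing.lean`;
Liśkiewicz–Ogihara–Toda 2003, proof of Theorem 7) anchored at one tile form the BUNDLE of that
tile, a function of few parameters (`tileBundle`, `clauseBundle`, `doublerBundle` of
`GridSAWFormulaStamps.lean`). The pair checks of `GridSAWFormulaStampChecks.lean` are filtered by
`mayCooccur`; this file decides, at the level of bundles, that every pair of kinds that CAN be
anchored at near tiles of an actual drawing passes that filter: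

* `BSpec` — the parameters of a bundle (`tile tk west east above`, `clause land3 above role east`,
  `doubler`), `BSpec.bundle`;
* `realizable b₁ b₂ Δ` — the constraints the construction imposes on the parameters of two tiles at
  offset `Δ` (neighbour flags, the kind of the tile above a crossing or a terminal, the succession of
  terminal roles inside a clause);
* **`mayCooccur_of_realizable`** — for `Δ ∈ {(0,0), (0,±1), (0,±2), (±1,0)}` by `decide`, for the
  remaining near offsets from the row classes of the bundles (`rowClass_bundle`).

## References

* M. Liśkiewicz, M. Ogihara, S. Toda, TCS 304 (2003) 129–156, §4 (proof of Theorem 7).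
-/

namespace Literature.Barriers.CriticalPhenomena.GridSAW.FormulaDrawing

/-! ### Bundle parameters -/

/-- **The parameters of the bundle of one tile.** [folklore] -/
inductive BSpec
  | tile (tk : TK3) (west east : Bool) (above : TK3)
  | clause (land3 : Bool) (above : TK3) (role : Role) (east : Bool)
  | doubler
  deriving DecidableEq, Repr

namespace BSpec

/-- The kinds anchored at a tile with the given parameters. [folklore] -/
def bundle : BSpec → List Kind
  | tile tk w e ab => tileBundle tk w e ab
  | clause l ab r e => clauseBundle l ab r e
  | doubler => doublerBundle

/-- All parameter values. [folklore] -/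
def all : List BSpec :=
  (TK3.all.flatMap fun tk => [true, false].flatMap fun w => [true, false].flatMap fun e =>
    TK3.all.map fun ab => tile tk w e ab) ++
  ([true, false].flatMap fun l => TK3.all.flatMap fun ab => Role.all.flatMap fun r =>
    [true, false].map fun e => clause l ab r e) ++
  [doubler]

/-- `all` is complete. [folklore] -/
theorem mem_all (b : BSpec) : b ∈ all := by
  rcases b with ⟨tk, w, e, ab⟩ | ⟨l, ab, r, e⟩ | _
  · cases tk <;> cases w <;> cases e <;> cases ab <;> decide
  · cases l <;> cases ab <;> cases r <;> cases e <;> decide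
  · decide

/-- The row class of a bundle. [folklore] -/
def rowClass : BSpec → RowClass
  | tile .. => .tile
  | clause .. => .clause
  | doubler => .tile

/-- Has a west / east neighbour in its row (for the flags the filter reads). [folklore] -/
def west : BSpec → Bool
  | tile _ w _ _ => w
  | clause .. => true
  | doubler => false

/-- Has an east neighbour. [folklore] -/
def east : BSpec → Bool
  | tile _ _ e _ => e
  | clause _ _ _ e => e
  | doubler => true

end BSpec

/-- The role of the next terminal to the east inside the clause row. [folklore] -/
def Role.succOK : Role → Role → Bool
  | .or1, .or1 | .or1, .or3a | .or3a, .or3b | .or3b, .or3c | .or3c, .or1 | .or3c, .or3a => true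
  | _, _ => false

/-- **Realisable pairs of bundles at a tile offset** `Δ` (the second `Δ.1` rows below, `Δ.2` columns
east): the constraints of the construction that the filter `mayCooccur` relies on. [folklore] -/
def realizable (b₁ b₂ : BSpec) (Δ : ℤ × ℤ) : Bool :=
  match b₁, b₂ with
  | .tile tk₁ _ e₁ _, .tile tk₂ w₂ _ ab₂ =>
    (decide (Δ = (0, 0)) && decide (b₁ = b₂)) ||
    (decide (Δ = (0, 1)) && e₁ && w₂) || (decide (Δ = (0, -1)) && b₂.east && b₁.west) ||
    (decide (Δ = (0, 2)) && e₁ && w₂) || (decide (Δ = (0, -2)) && b₂.east && b₁.west) ||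
    (decide (Δ = (1, 0)) && (!decide (tk₂ = .c) || (decide (ab₂ = tk₁) && !decide (tk₁ = .e)))) ||
    (decide (Δ = (-1, 0)) && (!decide (tk₁ = .c) || (decide (b₁ = .tile tk₁ b₁.west e₁ tk₂) && !decide (tk₂ = .e)))) ||
    (!decide (Δ.1 = 0) && !decide (Δ.2 = 0))
  | .tile tk₁ _ _ _, .clause _ ab₂ _ _ =>
    (decide (Δ = (1, 0)) && decide (ab₂ = tk₁) && !decide (tk₁ = .e)) || (decide (Δ.1 = 1) && !decide (Δ.2 = 0))
  | .clause _ ab₁ _ _, .tile tk₂ _ _ _ =>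
    (decide (Δ = (-1, 0)) && decide (ab₁ = tk₂) && !decide (tk₂ = .e)) || (decide (Δ.1 = -1) && !decide (Δ.2 = 0))
  | .clause _ _ r₁ e₁, .clause _ _ r₂ e₂ =>
    (decide (Δ = (0, 0)) && decide (b₁ = b₂)) ||
    (decide (Δ = (0, 1)) && e₁ && r₁.succOK r₂) || (decide (Δ = (0, -1)) && e₂ && r₂.succOK r₁) ||
    (decide (Δ = (0, 2)) && e₁ && (Role.all.any fun r => r₁.succOK r && r.succOK r₂)) ||
    (decide (Δ = (0, -2)) && e₂ && (Role.all.any fun r => r₂.succOK r && r.succOK r₁))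
  | .doubler, .doubler => decide (Δ = (0, 0))
  | .doubler, .tile _ w₂ _ _ => (decide (Δ = (0, 1)) && !w₂) || (decide (Δ = (0, 2)) && w₂) || (decide (Δ.1 = 1) && decide (1 ≤ Δ.2))
  | .tile _ w₁ _ _, .doubler => (decide (Δ = (0, -1)) && !w₁) || (decide (Δ = (0, -2)) && w₁) || (decide (Δ.1 = -1) && decide (Δ.2 ≤ -1))
  | .doubler, .clause .. => decide (Δ.1 = 1) && decide (1 ≤ Δ.2)
  | .clause .., .doubler => decide (Δ.1 = -1) && decide (Δ.2 ≤ -1)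

/-! ### Row classes of bundles -/

/-- Every kind of a bundle has the row class of the bundle. [folklore] -/
theorem rowClass_bundle : ∀ b ∈ BSpec.all, ∀ κ ∈ b.bundle, κ.rowClass = b.rowClass := by
  decide +kernel

/-- The same, for any parameters. [folklore] -/
theorem rowClass_of_mem_bundle {b : BSpec} {κ : Kind} (h : κ ∈ b.bundle) : κ.rowClass = b.rowClass :=
  rowClass_bundle b (BSpec.mem_all b) κ h

/-! ### The decided soundness of the filter on realisable bundles -/

/-- The offsets handled by the bundle-level decide. [folklore] -/
def axisOffsets : List (ℤ × ℤ) := [(0, 0), (0, 1), (0, -1), (0, 2), (0, -2), (1, 0), (-1, 0)]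

set_option maxHeartbeats 4000000 in
/-- **On the axis offsets, realisable pairs of bundles consist of pairs of kinds passing the
filter.** [folklore] -/
theorem mayCooccur_axis :
    (BSpec.all.all fun b₁ => BSpec.all.all fun b₂ => axisOffsets.all fun Δ =>
      !realizable b₁ b₂ Δ || (b₁.bundle.all fun κ₁ => b₂.bundle.all fun κ₂ =>
        (decide (κ₁ = κ₂) && decide (Δ = (0, 0))) || mayCooccur κ₁ κ₂ Δ)) = true := by
  decide +kernel

/-- The near offsets off the axes. [folklore] -/
def offAxisOffsets : List (ℤ × ℤ) := [(-1, -2), (-1, -1), (-1, 1), (-1, 2), (1, -2), (1, -1), (1, 1), (1, 2)]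

/-- **Off the axes the filter only reads row classes.** [folklore] -/
theorem mayCooccur_offAxis :
    (Kind.all.all fun κ₁ => Kind.all.all fun κ₂ => offAxisOffsets.all fun Δ =>
      (decide (Δ.1 = 1) && !decide (κ₁.rowClass = .tile)) || (decide (Δ.1 = -1) && !decide (κ₂.rowClass = .tile)) ||
        mayCooccur κ₁ κ₂ Δ) = true := by
  decide +kernel

/-- A near offset is an axis offset or off the axes. [folklore] -/
theorem mem_axis_or_offAxis {a b : ℤ} (ha : -1 ≤ a) (ha' : a ≤ 1) (hb : -2 ≤ b) (hb' : b ≤ 2) :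
    (a, b) ∈ axisOffsets ∨ (a, b) ∈ offAxisOffsets := by
  interval_cases a <;> interval_cases b <;> decide

/-! ### Facts about bundles used by the assembly -/

namespace Ref

/-- The tile offset of a reference. [folklore] -/
def offset : Ref → ℤ × ℤ
  | .cell di dj _ _ => (di, dj)
  | .gad di dj _ _ => (di, dj)

/-- A reference to a cell vertex. [folklore] -/
def isCell : Ref → Bool
  | .cell .. => true
  | .gad .. => false

end Ref

namespace BSpec

/-- Own references admissible in a bundle of the given parameters: cells at the positions the tile
has, gadget family codes of its row class, OR-gadget vertices only at heads. [folklore] -/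
def keyOK (b : BSpec) : Ref → Bool
  | .cell di dj c _ => decide (di = 0 ∧ dj = 0) &&
      (match b with | .tile .. => decide (c ≤ 2) | .clause .. => decide (c = 0) | .doubler => decide (c = 2))
  | .gad di dj f _ => decide (di = 0 ∧ dj = 0) &&
      (match b with
        | .tile .. => decide (f ≤ 5)
        | .clause _ _ r _ => decide (f = 6 ∨ (f = 7 ∧ (r = .or1 ∨ r = .or3a)))
        | .doubler => false)

/-- Offsets of foreign references admissible in a bundle of the given parameters. [folklore] -/
def offOK (b : BSpec) (Δ : ℤ × ℤ) : Bool :=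
  decide (Δ = (0, 0)) ||
  (decide (Δ = (0, -1)) && (match b with | .tile _ w _ _ => w | _ => false)) ||
  (decide (Δ = (-1, 0)) && (match b with | .tile tk _ _ _ => decide (tk = .c) | .clause .. => true | .doubler => false)) ||
  (decide (Δ = (0, 1)) && b.east) ||
  (decide (Δ = (0, 2)) && (match b with | .clause _ _ r _ => decide (r = .or3a) | _ => false))

end BSpec

/-- **Bundles list each kind once.** [folklore] -/
theorem bundle_nodup : ∀ b ∈ BSpec.all, b.bundle.Nodup := by
  decide +kernel

/-- **Own references of different kinds of one bundle differ.** [folklore] -/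
theorem ownKeys_disjoint_bundle :
    (BSpec.all.all fun b => b.bundle.all fun κ₁ => b.bundle.all fun κ₂ =>
      decide (κ₁ = κ₂) || ((Kind.verts κ₁).all fun a => !((Kind.verts κ₂).map Prod.fst).contains a.1)) = true := by
  decide +kernel

/-- **Own references are admissible** for the parameters of their bundle. [folklore] -/
theorem keyOK_bundle :
    (BSpec.all.all fun b => b.bundle.all fun κ => (Kind.verts κ).all fun a => b.keyOK a.1) = true := by
  decide +kernel

/-- **Foreign references point at admissible offsets** for the parameters of their bundle. [folklore] -/
theorem offOK_bundle :
    (BSpec.all.all fun b => b.bundle.all fun κ => (Kind.phantoms κ).all fun a => b.offOK a.1.offset && a.1.isCell) = true := by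
  decide +kernel

set_option maxHeartbeats 4000000 in
/-- **Foreign references resolve**: in a realisable pair of bundles at an axis offset, every foreign
reference of a kind of the second bundle pointing at the first tile is an own reference of a kind of
the first bundle. [folklore] -/
theorem phantoms_resolve_bundle :
    (BSpec.all.all fun b₁ => BSpec.all.all fun b₂ => axisOffsets.all fun Δ =>
      !realizable b₁ b₂ Δ || (b₂.bundle.all fun κ₂ => (Kind.phantoms κ₂).all fun a =>
        !decide (a.1.offset = (-Δ.1, -Δ.2)) ||
          b₁.bundle.any fun κ₁ => ((Kind.verts κ₁).map Prod.fst).contains (Kind.reRef Δ a.1))) = true := by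
  decide +kernel

end Literature.Barriers.CriticalPhenomena.GridSAW.FormulaDrawing
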